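import Summits.BirchSwinnertonDyer.BirchSwinnertonDyer.Theses.EisensteinPrimes
import Summits.BirchSwinnertonDyer.Rank1Residual.X1.KellerYinIMC2HalvesPub
import HarnessLib

/-!
# Route `EisensteinPrimes` (rung K5), crux rank 2 `GoodLatticeBDPValue` — the line `halves` as a
# Theorems-side BRIDGE: the crux BY NAME from four PUBLISHED named facts and ONE preprint statement

Crux 2 of the route (stmt-BirchSwinnertonDyer-19032; row A1 of the FULL-BSD rank-≤1 programme:
class X1 type A, analytic rank 1, 7 892 census cells) is
`Theses.EisensteinPrimes.GoodLatticeBDPValue := KellerYin2024.thm308_imc2_bdpValue_goodLattice_OPEN`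
— Keller–Yin arXiv:2402.12781v2 Thm. 3.0.8 (IMC2) for the good lattice at an anomalous Eisenstein
prime, read at the trivial character. The registered skeleton of the line `halves` (v2, bsd-eis-ky
g6; `X1/KellerYinIMC2Halves{,H1,Pub}.lean`, p407283 / p407831 / p411059) composes it from five stubs,
four of which are PUBLISHED named facts of the tree (Castella–Hsieh 2018 Def. 3.7/Prop. 3.8;
Carayol; CGLS 2022 proof of Thm. 4.2.2 first half = Thm. 4.1.2 + Rem. 4.1.3 + Prop. 4.2.1 under (h1);
CGLS 2022 Thm. 5.1.3) and one — `∀ W p, GoodLatticeMuLambdaOnTree W p`, `μ = 0` and `λ`-equality at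
an anomalous prime = Keller–Yin Thm. 1.5.1 + Thms. 2.2.1–2.2.3 — is THE preprint content. This file
is the sorry-free part of that skeleton as ONE theorem with the five stubs as displayed hypotheses,
so that the crux's reduction to the single `μ/λ` statement is a tree theorem attached to the item
(`--supports`), not only an evidence file. Nothing asserted; no label moves; CONDITIONAL on the
named inputs. [cite: KellerYin2024, Thm. 3.0.8 (IMC2)]
[cite: CastellaGrossiLeeSkinner2022, Thm. 4.1.2, Rem. 4.1.3, Prop. 4.2.1, Thm. 5.1.3]
[cite: CastellaHsieh2018, Def. 3.7 and Prop. 3.8]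
-/

set_option autoImplicit false
set_option linter.dupNamespace false

namespace Summit.BirchSwinnertonDyer.BirchSwinnertonDyer.Theorems

open Literature.NumberTheory.EllipticCurves Literature.NumberTheory.EllipticCurves.ModularForms
  Literature.NumberTheory.EllipticCurves.CastellaGrossiLeeSkinner2022
  Summit.BirchSwinnertonDyer.Rank1Residual.X1.KellerYinHalves

/-- **Crux `GoodLatticeBDPValue` from four PUBLISHED named facts and ONE preprint statement.**
`hCH` (Castella–Hsieh 2018 Def. 3.7 + Prop. 3.8: the BDP frame exists at a good prime, p407586),
`hC` (Carayol: the level of the newform is the conductor), `hdiv` (CGLS 2022, proof of Thm. 4.2.2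
first half: `𝔛_E` torsion and `char_Λ(𝔛_E)Λ^ur ⊇ (𝓛_E)` in `Λ^ur[1/p]` under (h1), p410650), `hval`
(CGLS 2022 Thm. 5.1.3: the BDP value at `𝟙` on a frame, p410650) — all PUBLISHED — and `hml`
(`μ = 0` and `λ(𝔛) = λ(𝓛)` for the good lattice at an anomalous prime: Keller–Yin Thm. 1.5.1 +
Thms. 2.2.1–2.2.3, PREPRINT) imply the route item `GoodLatticeBDPValue` (= `h308`), by
`KellerYinHalves.thm308_of_cgls_of_muLambda` (p411059). CONDITIONAL; nothing booked.
[claim: KellerYin2024, status: under-review]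
[cite: KellerYin2024, Thm. 3.0.8 (IMC2), Thm. 1.5.1, Thms. 2.2.1–2.2.3]
[cite: CastellaGrossiLeeSkinner2022, proof of Thm. 4.2.2 (arXiv:2008.02571v2 TeX L2343–L2352), Thm. 5.1.3 (L2463–L2471)]
[cite: CastellaHsieh2018, Def. 3.7 and Prop. 3.8] [cite: Carayol1986] -/
theorem goodLatticeBDPValue_of_published_of_muLambda
    (hCH : castellaHsieh2018_exists_isBDPLFunction)
    (hC : ∀ (N : ℕ) [NeZero N], IsNewformOf.level_eq_conductorNorm (N := N))
    (hdiv : proofThm422_exists_isBDPLFunction_isTorsion_charIdeal_dvd)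
    (hval : thm513_exists_isBDPLFunction_valueAtOne)
    (hml : ∀ (W : WeierstrassCurve ℚ) [W.IsElliptic] [W.IsGloballyMinimal] (p : ℕ) [Fact p.Prime],
      GoodLatticeMuLambdaOnTree W p) :
    Summit.BirchSwinnertonDyer.BirchSwinnertonDyer.Theses.EisensteinPrimes.GoodLatticeBDPValue := by
  unfold Summit.BirchSwinnertonDyer.BirchSwinnertonDyer.Theses.EisensteinPrimes.GoodLatticeBDPValue
  exact thm308_of_cgls_of_muLambda hCH hC hdiv hval hml

end Summit.BirchSwinnertonDyer.BirchSwinnertonDyer.Theorems
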